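import Summits.KontsevichZagierPeriods.KontsevichZagierPeriods.Theorems.AbelContractionRealHyperellipticSectorBudgetKit

/-!
# Route AbelContraction — `RealHyperellipticSector` (crux stmt-KontsevichZagierPeriods-12475): signed sums over a common domain

Helper file of the line `Lines/birth.lean` (registered brick `engine_signed_sum_mem_relationsLE`
of the stub `stub_engine`, `--supports` the crux). The engine pushes every oval integral forward
to one half-line and is left with representations `s i` (dimension `k ≤ d`) over a COMMON domain
`σ` whose SIGNED integrands cancel pointwise, `Σᵢ εᵢ · (s i).integrand = 0` on `σ` with integer
signs `εᵢ` (in the application `εᵢ = (−1)^i`); the brick concludes `Σᵢ εᵢ • [s i] ∈ KZ.relationsLE d`.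

Proof: integer scaling is iterated integrand additivity (rule 1(b)) INSIDE the budget —
`[σ, a f] − [σ, b f] − [σ, c f]` is a (1b) instance whenever `a = b + c`
(`SignedSum.of_constMul_sub_sub_mem`), whence `[σ, z f] − z • [σ, f] ∈ relationsLE d` for every
integer `z` by induction (`SignedSum.of_constMul_sub_zsmul_mem`); and the scaled representations
`[σ, εᵢ fᵢ]` have a common domain and integrands summing to `0` pointwise, so their sum lies in
`relationsLE d` by the unsigned bookkeeping lemma
`AbelContractionLemma.sum_of_mem_relationsLE_of_sum_eqOn_zero`.

References: M. Kontsevich, D. Zagier, *Periods* (2001), §1.1 ("rational" may be replaced by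
"algebraic": the scaled representation `KZ.IntegralRep.constMul`) and §1.2 rule (1)
[KontsevichZagier2001]; the truncation `KZ.relationsLE` is the construction of
`Literature/NumberTheory/Transcendental/KZRelationsLE.lean`. No definitions are introduced.
-/

noncomputable section

open Set MeasureTheory
open Literature.ModelTheory.ExponentialFields
open Literature.NumberTheory.Transcendental Literature.NumberTheory.Transcendental.KZ
open Summit.KontsevichZagierPeriods.AbelContraction.AbelContractionLemma
  (mem_relationsLE_of_integrandAdd of_mem_relationsLE_of_eqOn_zero
    sum_of_mem_relationsLE_of_sum_eqOn_zero)

namespace Summit.KontsevichZagierPeriods.AbelContraction.RealHyperellipticSector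

namespace SignedSum

variable {k d : ℕ}

/-- **One scaling step is rule 1(b)**: for real algebraic constants with `a = b + c` and a
representation `[σ, f]` of dimension `k ≤ d`, `[σ, a f] − [σ, b f] − [σ, c f] ∈ relationsLE d`
(an integrand-additivity instance: `a f = b f + c f` on `σ`).
[cite: KontsevichZagier2001, §1.2 rule (1)] -/
theorem of_constMul_sub_sub_mem (hk : k ≤ d) (r : IntegralRep k) {a b c : ℝ}
    (ha : IsAlgebraic ℚ a) (hb : IsAlgebraic ℚ b) (hc : IsAlgebraic ℚ c) (h : a = b + c) :
    of (r.constMul a ha) - of (r.constMul b hb) - of (r.constMul c hc) ∈ relationsLE d :=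
  mem_relationsLE_of_integrandAdd hk rfl rfl fun x _ => by
    simp only [IntegralRep.integrand_constMul, Pi.add_apply, h, add_mul]

/-- **The zero multiple is a truncated relation**: `[σ, 0 · f] ∈ relationsLE d` for a
representation of dimension `k ≤ d` (its integrand vanishes on `σ`).
[cite: KontsevichZagier2001, §1.2 rule (1)] -/
theorem of_constMul_mem_of_eq_zero (hk : k ≤ d) (r : IntegralRep k) {a : ℝ}
    (ha : IsAlgebraic ℚ a) (h : a = 0) : of (r.constMul a ha) ∈ relationsLE d :=
  of_mem_relationsLE_of_eqOn_zero hk _ fun x _ => by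
    simp only [IntegralRep.integrand_constMul, h, zero_mul, Pi.zero_apply]

/-- **The unit multiple is congruent to the representation**: `[σ, 1 · f] − [σ, f] ∈ relationsLE d`
for a representation of dimension `k ≤ d` (same domain, integrands agree on it).
[cite: KontsevichZagier2001, §1.2 rule (1)] -/
theorem of_constMul_sub_of_mem_of_eq_one (hk : k ≤ d) (r : IntegralRep k) {a : ℝ}
    (ha : IsAlgebraic ℚ a) (h : a = 1) : of (r.constMul a ha) - of r ∈ relationsLE d :=
  Budget.congr_mem_relationsLE hk rfl fun x _ => by
    simp only [IntegralRep.integrand_constMul, h, one_mul]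

/-- **Integer scaling is iterated integrand additivity inside the budget**: for every integer `z`
and every representation `[σ, f]` of dimension `k ≤ d`, `[σ, z f] − z • [σ, f] ∈ relationsLE d`
(induction on `z`: the step `[σ, (z ± 1) f] − [σ, z f] − [σ, ±f]` is a (1b) instance, and
`[σ, −f] + [σ, f] ≡ [σ, 0 · f] ≡ 0`). [cite: KontsevichZagier2001, §1.2 rule (1)] -/
theorem of_constMul_sub_zsmul_mem (hk : k ≤ d) (r : IntegralRep k) (z : ℤ) {a : ℝ}
    (ha : IsAlgebraic ℚ a) (h : a = z) : of (r.constMul a ha) - z • of r ∈ relationsLE d := by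
  induction z generalizing a with
  | zero =>
    rw [zero_zsmul, sub_zero]
    exact of_constMul_mem_of_eq_zero hk r ha (by rw [h, Int.cast_zero])
  | succ i ih =>
    have h1 := of_constMul_sub_sub_mem hk r ha (isAlgebraic_int (i : ℤ)) isAlgebraic_one
      (b := ((i : ℤ) : ℝ)) (c := 1) (by rw [h]; push_cast; ring)
    have h2 := ih (isAlgebraic_int (i : ℤ)) rfl
    have h3 := of_constMul_sub_of_mem_of_eq_one hk r isAlgebraic_one (rfl : (1 : ℝ) = 1)
    have e : of (r.constMul a ha) - ((i : ℤ) + 1) • of r =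
        (of (r.constMul a ha) - of (r.constMul ((i : ℤ) : ℝ) (isAlgebraic_int (i : ℤ))) -
            of (r.constMul 1 isAlgebraic_one)) +
          (of (r.constMul ((i : ℤ) : ℝ) (isAlgebraic_int (i : ℤ))) - (i : ℤ) • of r) +
          (of (r.constMul 1 isAlgebraic_one) - of r) := by
      rw [add_zsmul, one_zsmul]; abel
    rw [e]
    exact add_mem (add_mem h1 h2) h3
  | pred i ih =>
    have h1 := of_constMul_sub_sub_mem hk r ha (isAlgebraic_int (-(i : ℤ))) (isAlgebraic_int (-1))
      (b := ((-(i : ℤ) : ℤ) : ℝ)) (c := ((-1 : ℤ) : ℝ)) (by rw [h]; push_cast; ring)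
    have h2 := ih (isAlgebraic_int (-(i : ℤ))) rfl
    have h3 := of_constMul_sub_sub_mem hk r isAlgebraic_zero (isAlgebraic_int (-1)) isAlgebraic_one
      (a := 0) (b := ((-1 : ℤ) : ℝ)) (c := 1) (by push_cast; ring)
    have h4 := of_constMul_mem_of_eq_zero hk r isAlgebraic_zero (rfl : (0 : ℝ) = 0)
    have h5 := of_constMul_sub_of_mem_of_eq_one hk r isAlgebraic_one (rfl : (1 : ℝ) = 1)
    have e : of (r.constMul a ha) - (-(i : ℤ) - 1) • of r =
        (of (r.constMul a ha) - of (r.constMul ((-(i : ℤ) : ℤ) : ℝ) (isAlgebraic_int (-(i : ℤ)))) -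
            of (r.constMul ((-1 : ℤ) : ℝ) (isAlgebraic_int (-1)))) +
          (of (r.constMul ((-(i : ℤ) : ℤ) : ℝ) (isAlgebraic_int (-(i : ℤ)))) - (-(i : ℤ)) • of r) +
          of (r.constMul 0 isAlgebraic_zero) -
          (of (r.constMul 0 isAlgebraic_zero) - of (r.constMul ((-1 : ℤ) : ℝ) (isAlgebraic_int (-1))) -
            of (r.constMul 1 isAlgebraic_one)) -
          (of (r.constMul 1 isAlgebraic_one) - of r) := by
      rw [sub_zsmul, one_zsmul]; abel
    rw [e]
    exact sub_mem (sub_mem (add_mem (add_mem h1 h2) h4) h3) h5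

end SignedSum

/-- **Brick `engine_signed_sum_mem_relationsLE` of `stub_engine`** (crux
stmt-KontsevichZagierPeriods-12475): representations `s i` of dimension `k ≤ d` over a COMMON
domain `σ` whose signed integrands cancel pointwise — `Σᵢ εᵢ · (s i).integrand = 0` on `σ`, with
integer signs `εᵢ` — satisfy `Σᵢ εᵢ • [s i] ∈ KZ.relationsLE d`. (The scaled representations
`[σ, εᵢ fᵢ]` sum to a truncated relation by the unsigned lemma, and `[σ, εᵢ fᵢ] ≡ εᵢ • [σ, fᵢ]`
inside the budget by iterated rule 1(b).) [cite: KontsevichZagier2001, §1.2 rule (1)] -/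
theorem engine_signed_sum_mem_relationsLE : ∀ {k d : ℕ}, k ≤ d → ∀ {n : ℕ} (σ : Set (Fin k → ℝ))
    (s : Fin n → KZ.IntegralRep k) (ε : Fin n → ℤ), (∀ i, (s i).domain = σ) →
    (∀ p ∈ σ, ∑ i, (ε i : ℝ) * (s i).integrand p = 0) →
    ∑ i, ε i • KZ.of (s i) ∈ KZ.relationsLE d := by
  intro k d hk n σ s ε hdom h0
  have h1 : ∑ i, of ((s i).constMul ((ε i : ℤ) : ℝ) (isAlgebraic_int (ε i))) ∈ relationsLE d :=
    sum_of_mem_relationsLE_of_sum_eqOn_zero hk Finset.univ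
      (fun i => (s i).constMul ((ε i : ℤ) : ℝ) (isAlgebraic_int (ε i))) σ (fun i _ => hdom i)
      fun p hp => by simpa only [IntegralRep.integrand_constMul] using h0 p hp
  have h2 : ∑ i, (of ((s i).constMul ((ε i : ℤ) : ℝ) (isAlgebraic_int (ε i))) - ε i • of (s i)) ∈
      relationsLE d :=
    sum_mem fun i _ =>
      SignedSum.of_constMul_sub_zsmul_mem hk (s i) (ε i) (isAlgebraic_int (ε i)) rfl
  have h3 := sub_mem h1 h2
  rwa [Finset.sum_sub_distrib, sub_sub_cancel] at h3

end Summit.KontsevichZagierPeriods.AbelContraction.RealHyperellipticSector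

end
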